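import Literature.Analysis.FluidPDE.DriftMildBootstrap
import Literature.Analysis.FluidPDE.BoundedL2ClassicalMild
import Literature.Analysis.FluidPDE.ClassicalSolutionRescale
import Literature.Analysis.FluidPDE.LongLivedOseenSolution
import HarnessLib

/-!
# Quantitative gradient smoothing of bounded classical solutions: `‖∇u(t)‖ ≤ C G²/ν`
# after time `ν/G²`

Analysis/FluidPDE proof file (theorems only, everything proved). The tree proves KNSS 2009's
spatial regularity (4.10) for drift-mild pairs with constants depending only on `(k, δ, N)`
(`IsDriftMildOn.exists_norm_iteratedFDeriv_le`, `DriftMildBootstrap.lean`) and the Oseen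
representation of bounded classical solutions with uniformly square-integrable slices
(`mild_of_bounded_of_eLpNorm_two_le_of_lt`, `BoundedL2ClassicalMild.lean`). Composing the two with
the parabolic scaling of classical solutions (`IsClassicalNSSolutionOn.stRescale`) gives the
**quantitative** first-order smoothing estimate for bounded classical solutions of the unforced
Navier–Stokes system on `ℝ³`, in the scale-invariant form used by blow-up and level-set arguments:

* `exists_norm_fderiv_le_of_classical_unit` — ONE constant `C₁` such that every classical solution
  (`ν = 1`) on `ℝ³ × (a, b)`, bounded by `1` and with slices uniformly in `L²` on `(a, T]`, `T < b`,
  has `‖∇u(t, x)‖ ≤ C₁` for all `x` and all `t ∈ (a + 1, T)`;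
* `exists_norm_fderiv_le_of_speed_le` — ONE constant `C` such that every classical solution with
  viscosity `ν > 0` on `ℝ³ × [0, T)`, bounded by `G > 0` on `[0, T']` (`T' < T`) and with slices
  uniformly in `L²` there, has `‖∇u(t, x)‖ ≤ C G² / ν` for all `x` and all `t ∈ (ν/G², T')`
  (scaling `u ↦ G⁻¹ u(νt/G², νx/G)` to the unit case).

This is the `k = 1` case of the quantitative form of KNSS 2009, Prop. 4.1 / (4.10), which the named
fact `knss2009_smoothing` deliberately leaves unvendored ("the quantitative short-time estimate of
Prop. 4.1 … not vendored"); finite energy replaces the mild hypothesis (KNSS 2009, §1 p. 3).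

## References

* G. Koch, N. Nadirashvili, G. Seregin, V. Šverák, Acta Math. 203 (2009) = arXiv:0709.3599, §4,
  Prop. 4.1, (4.10). [KochNadirashviliSereginSverak2009]
-/

noncomputable section

open MeasureTheory Set Function Filter
open scoped ENNReal NNReal

namespace Literature.Analysis.FluidPDE

open UnboundedOperators (heatExtension)

/-! ### Unit viscosity, unit bound -/

/-- **Gradient bound for unit-bounded classical solutions (`ν = 1`).** There is a constant `C₁`
such that: for every classical solution `(u, p)` of the unforced Navier–Stokes system (`ν = 1`) on
`ℝ³ × (a, b)` with `‖u‖ ≤ 1` on `(a, T] × ℝ³`, `T < b`, and `‖u(t)‖_{L²} ≤ K < ∞` there,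
`‖∇u(t, x)‖ ≤ C₁` for all `x` and all `t ∈ (a + 1, T)` (the solution, cut off to `0` outside
`(a, T)`, is a drift-mild pair with zero drift and bound `1` by
`mild_of_bounded_of_eLpNorm_two_le_of_lt`; then KNSS (4.10) for drift-mild pairs,
`IsDriftMildOn.exists_norm_iteratedFDeriv_le`, `k = 1`, `δ = 1`).
[cite: KochNadirashviliSereginSverak2009, Prop. 4.1 and (4.10) (arXiv:0709.3599 §4)] -/
theorem exists_norm_fderiv_le_of_classical_unit :
    ∃ C₁ : ℝ, ∀ {a b T : ℝ} {u : ℝ → EuclideanSpace ℝ (Fin 3) → EuclideanSpace ℝ (Fin 3)}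
      {p : ℝ → EuclideanSpace ℝ (Fin 3) → ℝ}, IsClassicalNSSolutionOn (Ioo a b) 1 0 u p →
      a < T → T < b → (∀ t ∈ Ioc a T, ∀ x, ‖u t x‖ ≤ 1) → ∀ {K : ℝ≥0∞}, K ≠ ∞ →
      (∀ t ∈ Ioc a T, eLpNorm (u t) 2 volume ≤ K) →
      ∀ t ∈ Ioo (a + 1) T, ∀ x, ‖fderiv ℝ (u t) x‖ ≤ C₁ := by
  obtain ⟨C, hC⟩ := IsDriftMildOn.exists_norm_iteratedFDeriv_le
    (E := EuclideanSpace ℝ (Fin 3)) 1 (δ := 1) (N := 1) one_pos zero_le_one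
  refine ⟨C, ?_⟩
  intro a b T u p hcl haT hTb hbd K hK hL2 t ht x
  classical
  -- the cut-off field
  set S : Set (ℝ × EuclideanSpace ℝ (Fin 3)) := Ioo a T ×ˢ univ with hS
  set U : ℝ → EuclideanSpace ℝ (Fin 3) → EuclideanSpace ℝ (Fin 3) :=
    fun τ y => if τ ∈ Ioo a T then u τ y else 0 with hU
  have hUeq : ∀ {τ : ℝ}, τ ∈ Ioo a T → U τ = u τ := by
    intro τ hτ; funext y; simp only [hU, if_pos hτ]
  have hUunc : uncurry U = S.piecewise (uncurry u) 0 := by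
    funext z
    obtain ⟨τ, y⟩ := z
    by_cases hτ : τ ∈ Ioo a T
    · have hz : (τ, y) ∈ S := mk_mem_prod hτ (mem_univ y)
      simp only [uncurry_apply_pair, hU, if_pos hτ, piecewise_eq_of_mem _ _ _ hz]
    · have hz : (τ, y) ∉ S := fun h => hτ (mem_prod.1 h).1
      simp only [uncurry_apply_pair, hU, if_neg hτ, piecewise_eq_of_notMem _ _ _ hz,
        Pi.zero_apply]
  have hmeas : Measurable (uncurry U) := by
    rw [hUunc]
    refine ContinuousOn.measurable_piecewise ?_ continuousOn_const
      (measurableSet_Ioo.prod MeasurableSet.univ)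
    exact hcl.smooth_velocity.continuousOn.mono (prod_mono (Ioo_subset_Ioo_right hTb.le) subset_rfl)
  have hDM : IsDriftMildOn a T 1 U (fun _ => (0 : EuclideanSpace ℝ (Fin 3))) := by
    refine ⟨hmeas, measurable_const, ?_, fun _ => by simp, ?_⟩
    · intro τ hτ y
      rw [hUeq hτ]
      exact hbd τ ⟨hτ.1, hτ.2.le⟩ y
    · intro s t' hs hst ht' y
      have hsI : s ∈ Ioo a T := ⟨hs, hst.trans ht'⟩
      have htI : t' ∈ Ioo a T := ⟨hs.trans hst, ht'⟩
      have hadd : (fun τ z => U τ z + (0 : EuclideanSpace ℝ (Fin 3))) = U := by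
        funext τ z; rw [add_zero]
      rw [hadd, hUeq htI, hUeq hsI]
      have hcongr : oseenDuhamel 1 s U U t' y = oseenDuhamel 1 s u u t' y :=
        LongLivedOseenSolution.oseenDuhamel_congr (fun τ hτ => hUeq ⟨hs.trans hτ.1, hτ.2.trans ht'⟩)
          (fun τ hτ => hUeq ⟨hs.trans hτ.1, hτ.2.trans ht'⟩) y
      rw [hcongr]
      exact mild_of_bounded_of_eLpNorm_two_le_of_lt hcl haT hTb hbd hK hL2 hs hst ht' y
  have htI : t ∈ Ioo a T := ⟨by linarith [ht.1], ht.2⟩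
  have h := hC hDM t ht x
  rwa [hUeq htI, norm_iteratedFDeriv_one] at h

/-! ### General viscosity and bound: the scale-invariant form -/

/-- **`L²` norm of a rescaled slice**: `‖y ↦ α u(x₀ + γ y)‖_{L²} = |α| γ^{-3/2} ‖u‖_{L²}` in the
form of an upper bound with the finite factor `ofReal |α| · (ofReal (γ³)⁻¹)^{1/2}`. [folklore] -/
theorem eLpNorm_two_smul_comp_affine_le {f : EuclideanSpace ℝ (Fin 3) → EuclideanSpace ℝ (Fin 3)}
    (α : ℝ) {γ : ℝ} (hγ : 0 < γ) (x₀ : EuclideanSpace ℝ (Fin 3)) :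
    eLpNorm (fun y => α • f (x₀ + γ • y)) 2 volume ≤
      ENNReal.ofReal |α| * (ENNReal.ofReal (γ ^ 3)⁻¹) ^ (1 / 2 : ℝ) * eLpNorm f 2 volume := by
  rw [eLpNorm_eq_lintegral_rpow_enorm_toReal (by norm_num) (by norm_num),
    eLpNorm_eq_lintegral_rpow_enorm_toReal (by norm_num) (by norm_num), ENNReal.toReal_ofNat]
  have h1 : ∫⁻ y, ‖α • f (x₀ + γ • y)‖ₑ ^ (2 : ℝ) =
      ‖α‖ₑ ^ (2 : ℝ) * ∫⁻ y, ‖f (x₀ + γ • y)‖ₑ ^ (2 : ℝ) := by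
    rw [← lintegral_const_mul' _ _ (ENNReal.rpow_ne_top_of_nonneg (by norm_num) enorm_ne_top)]
    refine lintegral_congr fun y => ?_
    rw [enorm_smul, ENNReal.mul_rpow_of_nonneg _ _ (by norm_num)]
  have h2 : ∫⁻ y, ‖f (x₀ + γ • y)‖ₑ ^ (2 : ℝ) =
      ENNReal.ofReal (γ ^ 3)⁻¹ * ∫⁻ x, ‖f x‖ₑ ^ (2 : ℝ) := by
    have := lintegral_comp_space_affine hγ x₀ (fun x => ‖f x‖ₑ ^ (2 : ℝ))
    rw [finrank_euclideanSpace_fin] at this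
    exact this
  rw [h1, h2, ENNReal.mul_rpow_of_nonneg _ _ (by norm_num : (0 : ℝ) ≤ 1 / 2),
    ENNReal.mul_rpow_of_nonneg _ _ (by norm_num : (0 : ℝ) ≤ 1 / 2), ← mul_assoc]
  gcongr
  · rw [← ENNReal.rpow_mul, show (2 : ℝ) * (1 / 2) = 1 by norm_num, ENNReal.rpow_one,
      Real.enorm_eq_ofReal_abs]

/-- **Quantitative gradient smoothing under a speed bound (scale-invariant form).** There is an
absolute constant `C` such that: for `ν > 0`, `G > 0`, every classical solution `(u, p)` of the
unforced Navier–Stokes system with viscosity `ν` on `ℝ³ × [0, T)` that is bounded by `G` on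
`[0, T'] × ℝ³` (`T' < T`) and has uniformly square-integrable slices there
(`‖u(t)‖_{L²} ≤ K < ∞`, e.g. any Leray–Hopf classical solution) satisfies
`‖∇u(t, x)‖ ≤ C · G² / ν` for all `x` and all `t ∈ (ν / G², T')` — KNSS 2009 (4.10), `k = 1`, made
quantitative by the scaling `u ↦ G⁻¹ u(νt/G², νx/G)` (unit viscosity, unit bound, unit delay).
[cite: KochNadirashviliSereginSverak2009, Prop. 4.1 and (4.10) (arXiv:0709.3599 §4)] -/
theorem exists_norm_fderiv_le_of_speed_le :
    ∃ C : ℝ, ∀ {ν T T' G : ℝ} {u : ℝ → EuclideanSpace ℝ (Fin 3) → EuclideanSpace ℝ (Fin 3)}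
      {p : ℝ → EuclideanSpace ℝ (Fin 3) → ℝ}, 0 < ν → 0 < G →
      IsClassicalNSSolutionOn (Ico 0 T) ν 0 u p → 0 < T' → T' < T →
      (∀ t ∈ Icc 0 T', ∀ x, ‖u t x‖ ≤ G) → ∀ {K : ℝ≥0∞}, K ≠ ∞ →
      (∀ t ∈ Icc 0 T', eLpNorm (u t) 2 volume ≤ K) →
      ∀ t ∈ Ioo (ν / G ^ 2) T', ∀ x, ‖fderiv ℝ (u t) x‖ ≤ C * G ^ 2 / ν := by
  obtain ⟨C₁, hC₁⟩ := exists_norm_fderiv_le_of_classical_unit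
  refine ⟨C₁, ?_⟩
  intro ν T T' G u p hν hG hcl hT' hT'T hbd K hK hL2 t ht x
  -- scaling parameters
  set α : ℝ := G⁻¹ with hα
  set γ : ℝ := ν / G with hγ
  set β : ℝ := ν / G ^ 2 with hβ
  have hαpos : 0 < α := by rw [hα]; positivity
  have hγpos : 0 < γ := by rw [hγ]; positivity
  have hβpos : 0 < β := by rw [hβ]; positivity
  have hβαγ : β = α * γ := by rw [hβ, hα, hγ]; field_simp
  -- the rescaled classical solution, unit viscosity, on `(0, T/β)`
  have hcl' := (hcl.mono Ioo_subset_Ico_self (uniqueDiffOn_Ioo 0 T)).stRescale hαpos hγpos hβαγ 0 0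
  have hS : ((fun r => (0 : ℝ) + β * r) ⁻¹' Ioo 0 T) = Ioo 0 (T / β) := by
    ext r
    simp only [mem_preimage, mem_Ioo, zero_add]
    constructor
    · rintro ⟨h1, h2⟩
      exact ⟨(mul_pos_iff_of_pos_left hβpos).1 h1, (lt_div_iff₀' hβpos).2 h2⟩
    · rintro ⟨h1, h2⟩
      exact ⟨mul_pos hβpos h1, (lt_div_iff₀' hβpos).1 h2⟩
  have hν1 : α * ν / γ = 1 := by rw [hα, hγ]; field_simp
  rw [hS, hν1, smul_stPull_zero] at hcl'
  set w : ℝ → EuclideanSpace ℝ (Fin 3) → EuclideanSpace ℝ (Fin 3) := α • stPull β γ 0 0 u with hw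
  -- bounds for `w` on `(0, T'/β]`
  have hwapp : ∀ s y, w s y = α • u (β * s) (γ • y) := by
    intro s y
    simp only [hw, Pi.smul_apply, stPull_apply, zero_add]
  have hT'β : 0 < T' / β := div_pos hT' hβpos
  have hT'βT : T' / β < T / β := div_lt_div_of_pos_right hT'T hβpos
  have hmemI : ∀ {s : ℝ}, s ∈ Ioc 0 (T' / β) → β * s ∈ Icc 0 T' := by
    intro s hs
    refine ⟨(mul_pos hβpos hs.1).le, ?_⟩
    have := hs.2
    rwa [le_div_iff₀' hβpos] at this
  have hbd' : ∀ s ∈ Ioc 0 (T' / β), ∀ y, ‖w s y‖ ≤ 1 := by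
    intro s hs y
    rw [hwapp, norm_smul, Real.norm_of_nonneg hαpos.le, hα]
    have := hbd (β * s) (hmemI hs) (γ • y)
    calc G⁻¹ * ‖u (β * s) (γ • y)‖ ≤ G⁻¹ * G := by gcongr
      _ = 1 := inv_mul_cancel₀ hG.ne'
  set K' : ℝ≥0∞ := ENNReal.ofReal |α| * (ENNReal.ofReal (γ ^ 3)⁻¹) ^ (1 / 2 : ℝ) * K with hK'
  have hK'top : K' ≠ ∞ := by
    refine ENNReal.mul_ne_top (ENNReal.mul_ne_top ENNReal.ofReal_ne_top ?_) hK
    exact ENNReal.rpow_ne_top_of_nonneg (by norm_num) ENNReal.ofReal_ne_top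
  have hL2' : ∀ s ∈ Ioc 0 (T' / β), eLpNorm (w s) 2 volume ≤ K' := by
    intro s hs
    have h1 : w s = fun y => α • u (β * s) ((0 : EuclideanSpace ℝ (Fin 3)) + γ • y) := by
      funext y; rw [hwapp, zero_add]
    rw [h1]
    refine (eLpNorm_two_smul_comp_affine_le α hγpos 0).trans ?_
    rw [hK']
    gcongr
    exact hL2 (β * s) (hmemI hs)
  -- the unit estimate for `w` at time `t/β ∈ (1, T'/β)`
  have htβ : t / β ∈ Ioo (0 + 1) (T' / β) := by
    refine ⟨?_, div_lt_div_of_pos_right ht.2 hβpos⟩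
    rw [zero_add, lt_div_iff₀ hβpos, one_mul]
    exact ht.1
  have key := hC₁ hcl' hT'β hT'βT hbd' hK'top hL2' (t / β) htβ (γ⁻¹ • x)
  -- undo the scaling in the derivative
  have htT : t ∈ Ico 0 T := ⟨(hβpos.trans ht.1).le, ht.2.trans hT'T⟩
  have hdiff : DifferentiableAt ℝ (stPull β γ 0 0 u (t / β)) (γ⁻¹ • x) :=
    differentiable_stPull_slice
      (((hcl.contDiff_velocity (by simpa [mul_div_cancel₀ _ hβpos.ne'] using htT)).differentiable
        (by simp))) _
  have hD : fderiv ℝ (w (t / β)) (γ⁻¹ • x) = (α * γ) • fderiv ℝ (u t) x := by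
    have h1 : w (t / β) = α • stPull β γ 0 0 u (t / β) := rfl
    rw [h1, fderiv_const_smul hdiff, fderiv_stPull, smul_smul]
    congr 2
    · rw [zero_add, mul_div_cancel₀ _ hβpos.ne']
    · rw [zero_add, smul_smul, mul_inv_cancel₀ hγpos.ne', one_smul]
  rw [hD, norm_smul, Real.norm_of_nonneg (by positivity)] at key
  -- `α γ = ν / G²`
  have hαγ : α * γ = ν / G ^ 2 := by rw [hα, hγ]; field_simp
  rw [hαγ] at key
  have hG2 : 0 < G ^ 2 := by positivity
  have key' : ‖fderiv ℝ (u t) x‖ ≤ C₁ / (ν / G ^ 2) := by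
    rw [le_div_iff₀ (div_pos hν hG2)]
    calc ‖fderiv ℝ (u t) x‖ * (ν / G ^ 2) = ν / G ^ 2 * ‖fderiv ℝ (u t) x‖ := mul_comm _ _
      _ ≤ C₁ := key
  calc ‖fderiv ℝ (u t) x‖ ≤ C₁ / (ν / G ^ 2) := key'
    _ = C₁ * G ^ 2 / ν := by field_simp

end Literature.Analysis.FluidPDE

end
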